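import Literature.Probability.Percolation.TwoClusterConditionalAssociationProofs
import HarnessLib

/-!
# The tripod exchange inequality `P(ox|yz) · P(oy|xz) ≤ P(oxz|y) · P(oyz|x)`
# — a corollary of van den Berg–Häggström–Kahn 2006, Thm. 1.5

Topic `Literature/Probability/Percolation`.  Bond percolation with arbitrary edge probabilities on a
finite vertex type `V` (`μ = prodBernoulli w` on `BondConfig V = Set (Sym2 V)`, `w e = p_e`), four
vertices `o, x, y, z`, and for a set partition `π` of `{o, x, y, z}` write `P(π)` for the probability
that the partition of `{o, x, y, z}` induced by the open clusters is exactly `π`.  This file PROVES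

  `P(ox|yz) · P(oy|xz) ≤ P(oxz|y) · P(oyz|x)`                                    (C⁺)

(`tripodExchange`), the "tripod exchange" asked for by the route
`Summits/CriticalPhenomena/PercolationContinuityZ3/Theses/PercNearOneGluingNoHeavy` (crux
`NoHeavyLowerTail`, stmt-CriticalPhenomena-4575: the `|A| = 3` one-cut step was reduced to (C⁺) by the
route's strategist).  In the tree's vocabulary the four cells are the events
`{o ↔ x} ∩ {y ↔ z} ∩ {x ↮ y}`, `{o ↔ y} ∩ {x ↔ z} ∩ {x ↮ y}`, `{o ↔ x} ∩ {x ↔ z} ∩ {x ↮ y}`,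
`{o ↔ y} ∩ {y ↔ z} ∩ {x ↮ y}` (given the two stated connections, `x ↮ y` is exactly the separation
of the two blocks, reachability being an equivalence relation).

## Status in print and derivation

(C⁺) is NOT stated in the literature searched (van den Berg–Kahn 2001; van den Berg–Häggström–Kahn
2006; Grimmett, *The Random-Cluster Model* §3; Kozma–Nitzan arXiv:2401.12397; Gladkov
arXiv:2408.08457; the bunkbed literature), but it is a five-line COROLLARY of
[VandenbergHaggstromKahn2005, Thm. 1.5 (p. 7, eq. (9))]: "Let `s` and `t` be (distinct) vertices,
and `f` and `g` bounded, measurable functions of `(C_s, C_t)`, each increasing in `C_s` and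
decreasing in `C_t`. Then `E[f g | s ↮ t] ≥ E[f | s ↮ t] E[g | s ↮ t]`. In other words, on `{s ↮ t}`
we have positive association of all the r.v.'s `1{e ∈ C_s}` and `1{e ∉ C_t}`" — in the tree the
named fact `BHK2006_twoClusterConditionalAssociation`, DISCHARGED by
`BHK2006_twoClusterConditionalAssociation_holds` (`TwoClusterConditionalAssociationProofs.lean`).

Derivation (this file).  Take `s = x`, `t = y`, `D = {x ↮ y}`; all four cells lie in `D`.  Put
`f₁ = 1{o ∈ C_x} 1{o ∉ C_y}`, `f₂ = 1{z ∈ C_x} 1{z ∉ C_y}` (increasing in `C_x`, decreasing in `C_y`)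
and `g₁ = 1{z ∈ C_y} 1{z ∉ C_x}`, `g₂ = 1{o ∈ C_y} 1{o ∉ C_x}` (the opposite type).  On `D`:
`f₁ g₁ = 1(ox|yz)`, `f₂ g₂ = 1(oy|xz)`, `f₁ f₂ = 1(oxz|y)`, `g₁ g₂ = 1(oyz|x)`.  Theorem 1.5 gives,
with `E' = E[· | D]`: (a) `E'f₁ E'f₂ ≤ E'[f₁f₂]`, (b) `E'g₁ E'g₂ ≤ E'[g₁g₂]` (Thm. 1.5 for
`(−g₁, −g₂)`), (c) `E'[f₁g₁] ≤ E'f₁ E'g₁`, (d) `E'[f₂g₂] ≤ E'f₂ E'g₂` (Thm. 1.5 for `(fᵢ, −gᵢ)`),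
whence `E'[f₁g₁] E'[f₂g₂] ≤ E'f₁ E'g₁ E'f₂ E'g₂ ≤ E'[f₁f₂] E'[g₁g₂]`; multiplying by `P(D)²` is
(C⁺) (and `P(D) = 0` makes the left side vanish).  As a polynomial inequality in the fifteen cell
probabilities this certificate has degree four, which is why the degree-two Harris–Kleitman /
Ahlswede–Daykin LP certificates on the partition lattice of `{o,x,y,z}` do not see (C⁺) (the
route's NARROW.md records an exact Farkas witness against those cones).  Equality holds on the
4-cycle `o–x–z–y–o` with equal weights (all four cells equal `p²(1−p)²`).

## Contents

* `TripodExchange.inOut_monotone_left` … `TripodExchange.inOut_openEdgeCluster` — the functions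
  `(C, D) ↦ F_a^s(C) · (1 − F_a^t(D))` of a pair of edge sets (`F_a^s = connIndicatorFn s a`, the
  tree's increasing function with `F_a^s(C_s ω) = 1{s ↔ a}(ω)`): monotone in `C`, antitone in `D`,
  and equal at `(C_s ω, C_t ω)` to the indicator of `{s ↔ a} ∩ {t ↮ a}`;
* `tripodExchange` — (C⁺), PROVED (no definition and no named fact is introduced; trust base =
  the kernel);
* `clusterEventExchange` — the general form (C⁺_gen): for increasing events `A₁, A₂` determined by
  `C_x` and `B₁, B₂` determined by `C_y`,
  `μ(D ∩ A₁ ∩ B₁) μ(D ∩ A₂ ∩ B₂) ≤ μ(D ∩ A₁ ∩ A₂) μ(D ∩ B₁ ∩ B₂)` (`D = {x ↮ y}`), PROVED the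
  same way (section "The general cluster-event exchange" at the end of the file).

## References

* J. van den Berg, O. Häggström, J. Kahn, *Some conditional correlation inequalities for
  percolation and related processes*, Random Structures Algorithms 29 (2006) 417–435
  (arXiv:math/0408176), Thm. 1.5, eq. (9), p. 7. [VandenbergHaggstromKahn2005]
* G. Kozma, S. Nitzan, *A reduction of the θ(p_c) = 0 problem to a conjectured inequality*,
  arXiv:2401.12397 (2024) (the route's source; (C⁺) is not stated there). [KozmaNitzan2024]
-/

noncomputable section

open MeasureTheory Set
open Literature.Probability.LatticeModels (prodBernoulli)

namespace Literature.Probability.Percolation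

variable {V : Type*}

namespace TripodExchange

/-! The function of a pair of edge sets `(C, D) ↦ F_a^s(C) · (1 − F_a^t(D))`, where
`F_a^s = connIndicatorFn s a` (`= 1{a = s or some edge of C contains a}`, the tree's increasing
function with `F_a^s(C_s ω) = 1{s ↔ a}(ω)`): evaluated at `(C_s ω, C_t ω)` it is the indicator of
`{s ↔ a} ∩ {t ↮ a}` ("`a` lies in the cluster of `s` and not in that of `t`"), a function
increasing in `C_s` and decreasing in `C_t` as in BHK's Theorem 1.5 ("positive association of all
the r.v.'s `1{e ∈ C_s}` and `1{e ∉ C_t}`", p. 7).  No definition is introduced: the product is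
written out in each statement. -/

/-- `C ↦ F_a^s(C) (1 − F_a^t(D))` is increasing in `C` (`F_a^t(D) ∈ {0, 1}`, so the second
factor is nonnegative). [folklore] -/
theorem inOut_monotone_left (s t a : V) (D : Set (Sym2 V)) :
    Monotone fun C => connIndicatorFn s a C * (1 - connIndicatorFn t a D) := by
  classical
  have h1 : connIndicatorFn t a D ≤ 1 := by
    unfold connIndicatorFn
    split_ifs <;> norm_num
  exact fun _ _ h => mul_le_mul_of_nonneg_right (monotone_connIndicatorFn s a h) (sub_nonneg.2 h1)

/-- `D ↦ F_a^s(C) (1 − F_a^t(D))` is decreasing in `D` (`F_a^s(C) ≥ 0`). [folklore] -/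
theorem inOut_antitone_right (s t a : V) (C : Set (Sym2 V)) :
    Antitone fun D => connIndicatorFn s a C * (1 - connIndicatorFn t a D) := by
  classical
  have h0 : 0 ≤ connIndicatorFn s a C := by
    unfold connIndicatorFn
    split_ifs <;> norm_num
  exact fun _ _ h =>
    mul_le_mul_of_nonneg_left (sub_le_sub_left (monotone_connIndicatorFn t a h) 1) h0

/-- `C ↦ −F_a^t(D) (1 − F_a^s(C))` is increasing in `C` (the opposite-type function, negated, is
of BHK's type). [folklore] -/
theorem neg_inOut_swap_monotone_left (s t a : V) (D : Set (Sym2 V)) :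
    Monotone fun C => -(connIndicatorFn t a D * (1 - connIndicatorFn s a C)) :=
  fun _ _ h => neg_le_neg (inOut_antitone_right t s a D h)

/-- `D ↦ −F_a^t(D) (1 − F_a^s(C))` is decreasing in `D`. [folklore] -/
theorem neg_inOut_swap_antitone_right (s t a : V) (C : Set (Sym2 V)) :
    Antitone fun D => -(connIndicatorFn t a D * (1 - connIndicatorFn s a C)) :=
  fun _ _ h => neg_le_neg (inOut_monotone_left t s a C h)

/-- Evaluation on a configuration: `F_a^s(C_s ω) (1 − F_a^t(C_t ω)) = 1({s ↔ a} ∩ {t ↮ a})(ω)`.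
[cite: VandenbergHaggstromKahn2005, §1 p. 3 ("A simple example of such an event is {s ↔ a}")] -/
theorem inOut_openEdgeCluster (ω : BondConfig V) (s t a : V) :
    connIndicatorFn s a (openEdgeCluster ω s) * (1 - connIndicatorFn t a (openEdgeCluster ω t)) =
      (openConn s a ∩ (openConn t a)ᶜ).indicator 1 ω := by
  rw [connIndicatorFn_openEdgeCluster, connIndicatorFn_openEdgeCluster]
  by_cases h1 : ω ∈ openConn s a <;> by_cases h2 : ω ∈ openConn t a <;>
    simp [h1, h2]

/-- `∫_D 1_S dμ = μ(D ∩ S)` for the (finite, discrete) percolation space. [folklore] -/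
theorem setIntegral_indicator_one_eq [Fintype V] (w : Sym2 V → unitInterval)
    (D S : Set (BondConfig V)) :
    ∫ ω in D, S.indicator (1 : BondConfig V → ℝ) ω ∂(prodBernoulli w) =
      (prodBernoulli w).real (D ∩ S) := by
  have hS : MeasurableSet S := MeasurableSet.of_discrete
  rw [setIntegral_indicator hS]
  simp only [Pi.one_apply, setIntegral_const, smul_eq_mul, mul_one]

/-- `∫_D 1_S 1_T dμ = μ(D ∩ (S ∩ T))`. [folklore] -/
theorem setIntegral_indicator_mul_indicator_eq [Fintype V] (w : Sym2 V → unitInterval)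
    (D S T : Set (BondConfig V)) :
    ∫ ω in D, S.indicator (1 : BondConfig V → ℝ) ω * T.indicator (1 : BondConfig V → ℝ) ω
        ∂(prodBernoulli w) =
      (prodBernoulli w).real (D ∩ (S ∩ T)) := by
  have hST : (fun ω => S.indicator (1 : BondConfig V → ℝ) ω * T.indicator (1 : BondConfig V → ℝ) ω)
      = (S ∩ T).indicator 1 :=
    funext fun ω => (congrFun (Set.inter_indicator_one (s := S) (t := T) (M₀ := ℝ)) ω).symm
  rw [hST]
  exact setIntegral_indicator_one_eq w D (S ∩ T)

end TripodExchange

open TripodExchange in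
/-- **The tripod exchange inequality (C⁺)** — for bond percolation with arbitrary edge
probabilities `w` on a finite vertex type and vertices `o, x, y, z`:
`P(ox|yz) · P(oy|xz) ≤ P(oxz|y) · P(oyz|x)`, where `P(π)` is the probability that the open
clusters partition `{o, x, y, z}` exactly as `π`; in events,
`μ({o↔x} ∩ {y↔z} ∩ {x↮y}) · μ({o↔y} ∩ {x↔z} ∩ {x↮y}) ≤ μ({o↔x} ∩ {x↔z} ∩ {x↮y}) · μ({o↔y} ∩ {y↔z} ∩ {x↮y})`.
Not stated in print; PROVED here as a corollary of van den Berg–Häggström–Kahn's Theorem 1.5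
(conditional positive association of `(1{e ∈ C_x}, 1{e ∉ C_y})` given `{x ↮ y}`), applied four
times — see the module docstring for the five-line derivation.
[cite: VandenbergHaggstromKahn2005, Thm. 1.5 (p. 7, eq. (9)) — corollary, derived in this file] -/
theorem tripodExchange [Fintype V] (w : Sym2 V → unitInterval) (o x y z : V) :
    (prodBernoulli w).real (openConn o x ∩ openConn y z ∩ (openConn x y)ᶜ) *
        (prodBernoulli w).real (openConn o y ∩ openConn x z ∩ (openConn x y)ᶜ) ≤
      (prodBernoulli w).real (openConn o x ∩ openConn x z ∩ (openConn x y)ᶜ) *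
        (prodBernoulli w).real (openConn o y ∩ openConn y z ∩ (openConn x y)ᶜ) := by
  classical
  by_cases hxy : x = y
  · -- degenerate case: `{x ↮ x} = ∅`, the left-hand side vanishes
    have hc : (openConn x y : Set (BondConfig V))ᶜ = ∅ := by
      ext ω
      simp only [mem_compl_iff, mem_empty_iff_false, iff_false, not_not, hxy]
      exact SimpleGraph.Reachable.refl y
    rw [hc, inter_empty, measureReal_empty, zero_mul]
    exact mul_nonneg measureReal_nonneg measureReal_nonneg
  -- the four applications of BHK 2006, Thm. 1.5 (s = x, t = y)
  -- `f₁ = F_o^x (1 − F_o^y)`, `f₂ = F_z^x (1 − F_z^y)`; `−g₁ = −F_z^y (1 − F_z^x)`, `−g₂ = −F_o^y (1 − F_o^x)`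
  have key_a := BHK2006_twoClusterConditionalAssociation_holds V w x y
    (fun C E => connIndicatorFn x o C * (1 - connIndicatorFn y o E))
    (fun C E => connIndicatorFn x z C * (1 - connIndicatorFn y z E))
    (fun E => inOut_monotone_left x y o E) (fun C => inOut_antitone_right x y o C)
    (fun E => inOut_monotone_left x y z E) (fun C => inOut_antitone_right x y z C) hxy
  have key_b := BHK2006_twoClusterConditionalAssociation_holds V w x y
    (fun C E => -(connIndicatorFn y z E * (1 - connIndicatorFn x z C)))
    (fun C E => -(connIndicatorFn y o E * (1 - connIndicatorFn x o C)))
    (fun E => neg_inOut_swap_monotone_left x y z E) (fun C => neg_inOut_swap_antitone_right x y z C)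
    (fun E => neg_inOut_swap_monotone_left x y o E) (fun C => neg_inOut_swap_antitone_right x y o C)
    hxy
  have key_c := BHK2006_twoClusterConditionalAssociation_holds V w x y
    (fun C E => connIndicatorFn x o C * (1 - connIndicatorFn y o E))
    (fun C E => -(connIndicatorFn y z E * (1 - connIndicatorFn x z C)))
    (fun E => inOut_monotone_left x y o E) (fun C => inOut_antitone_right x y o C)
    (fun E => neg_inOut_swap_monotone_left x y z E) (fun C => neg_inOut_swap_antitone_right x y z C)
    hxy
  have key_d := BHK2006_twoClusterConditionalAssociation_holds V w x y
    (fun C E => connIndicatorFn x z C * (1 - connIndicatorFn y z E))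
    (fun C E => -(connIndicatorFn y o E * (1 - connIndicatorFn x o C)))
    (fun E => inOut_monotone_left x y z E) (fun C => inOut_antitone_right x y z C)
    (fun E => neg_inOut_swap_monotone_left x y o E) (fun C => neg_inOut_swap_antitone_right x y o C)
    hxy
  have hDc : {ω : BondConfig V | ¬ (openGraph ω).Reachable x y} = (openConn x y)ᶜ := rfl
  simp only [hDc, inOut_openEdgeCluster, integral_neg, mul_neg, neg_mul, neg_neg,
    neg_le_neg_iff] at key_a key_b key_c key_d
  simp only [setIntegral_indicator_one_eq, setIntegral_indicator_mul_indicator_eq]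
    at key_a key_b key_c key_d
  -- the four cells as intersections with `D = {x ↮ y}`
  have mem : ∀ (ω : BondConfig V) (a b : V),
      ω ∈ (openConn a b : Set (BondConfig V)) ↔ (openGraph ω).Reachable a b := fun _ _ _ => Iff.rfl
  have e1 : (openConn o x ∩ openConn y z ∩ (openConn x y)ᶜ : Set (BondConfig V)) =
      (openConn x y)ᶜ ∩ ((openConn x o ∩ (openConn y o)ᶜ) ∩ (openConn y z ∩ (openConn x z)ᶜ)) := by
    ext ω
    simp only [mem_inter_iff, mem_compl_iff, mem]
    constructor
    · rintro ⟨⟨hox, hyz⟩, hxy'⟩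
      exact ⟨hxy', ⟨hox.symm, fun hyo => hxy' (hox.symm.trans hyo.symm)⟩, hyz,
        fun hxz => hxy' (hxz.trans hyz.symm)⟩
    · rintro ⟨hxy', ⟨hxo, -⟩, hyz, -⟩
      exact ⟨⟨hxo.symm, hyz⟩, hxy'⟩
  have e2 : (openConn o y ∩ openConn x z ∩ (openConn x y)ᶜ : Set (BondConfig V)) =
      (openConn x y)ᶜ ∩ ((openConn x z ∩ (openConn y z)ᶜ) ∩ (openConn y o ∩ (openConn x o)ᶜ)) := by
    ext ω
    simp only [mem_inter_iff, mem_compl_iff, mem]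
    constructor
    · rintro ⟨⟨hoy, hxz⟩, hxy'⟩
      exact ⟨hxy', ⟨hxz, fun hyz => hxy' (hxz.trans hyz.symm)⟩, hoy.symm,
        fun hxo => hxy' (hxo.trans hoy)⟩
    · rintro ⟨hxy', ⟨hxz, -⟩, hyo, -⟩
      exact ⟨⟨hyo.symm, hxz⟩, hxy'⟩
  have e3 : (openConn o x ∩ openConn x z ∩ (openConn x y)ᶜ : Set (BondConfig V)) =
      (openConn x y)ᶜ ∩ ((openConn x o ∩ (openConn y o)ᶜ) ∩ (openConn x z ∩ (openConn y z)ᶜ)) := by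
    ext ω
    simp only [mem_inter_iff, mem_compl_iff, mem]
    constructor
    · rintro ⟨⟨hox, hxz⟩, hxy'⟩
      exact ⟨hxy', ⟨hox.symm, fun hyo => hxy' (hox.symm.trans hyo.symm)⟩, hxz,
        fun hyz => hxy' (hxz.trans hyz.symm)⟩
    · rintro ⟨hxy', ⟨hxo, -⟩, hxz, -⟩
      exact ⟨⟨hxo.symm, hxz⟩, hxy'⟩
  have e4 : (openConn o y ∩ openConn y z ∩ (openConn x y)ᶜ : Set (BondConfig V)) =
      (openConn x y)ᶜ ∩ ((openConn y z ∩ (openConn x z)ᶜ) ∩ (openConn y o ∩ (openConn x o)ᶜ)) := by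
    ext ω
    simp only [mem_inter_iff, mem_compl_iff, mem]
    constructor
    · rintro ⟨⟨hoy, hyz⟩, hxy'⟩
      exact ⟨hxy', ⟨hyz, fun hxz => hxy' (hxz.trans hyz.symm)⟩, hoy.symm,
        fun hxo => hxy' (hxo.trans hoy)⟩
    · rintro ⟨hxy', ⟨hyz, -⟩, hyo, -⟩
      exact ⟨⟨hyo.symm, hyz⟩, hxy'⟩
  rw [e1, e2, e3, e4]
  -- bookkeeping: m² · L₁ L₂ ≤ (a₁ b₁)(a₂ b₂) = (a₁ a₂)(b₁ b₂) ≤ m² · R₁ R₂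
  set μ := prodBernoulli w with hμ
  set m := μ.real (openConn x y)ᶜ with hm_def
  set a1 := μ.real ((openConn x y)ᶜ ∩ (openConn x o ∩ (openConn y o)ᶜ)) with ha1
  set a2 := μ.real ((openConn x y)ᶜ ∩ (openConn x z ∩ (openConn y z)ᶜ)) with ha2
  set b1 := μ.real ((openConn x y)ᶜ ∩ (openConn y z ∩ (openConn x z)ᶜ)) with hb1
  set b2 := μ.real ((openConn x y)ᶜ ∩ (openConn y o ∩ (openConn x o)ᶜ)) with hb2
  set L1 := μ.real ((openConn x y)ᶜ ∩
    ((openConn x o ∩ (openConn y o)ᶜ) ∩ (openConn y z ∩ (openConn x z)ᶜ))) with hL1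
  set L2 := μ.real ((openConn x y)ᶜ ∩
    ((openConn x z ∩ (openConn y z)ᶜ) ∩ (openConn y o ∩ (openConn x o)ᶜ))) with hL2
  set R1 := μ.real ((openConn x y)ᶜ ∩
    ((openConn x o ∩ (openConn y o)ᶜ) ∩ (openConn x z ∩ (openConn y z)ᶜ))) with hR1
  set R2 := μ.real ((openConn x y)ᶜ ∩
    ((openConn y z ∩ (openConn x z)ᶜ) ∩ (openConn y o ∩ (openConn x o)ᶜ))) with hR2
  have hm0 : 0 ≤ m := measureReal_nonneg
  have ha1' : 0 ≤ a1 := measureReal_nonneg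
  have ha2' : 0 ≤ a2 := measureReal_nonneg
  have hb1' : 0 ≤ b1 := measureReal_nonneg
  have hb2' : 0 ≤ b2 := measureReal_nonneg
  have hL2' : 0 ≤ L2 := measureReal_nonneg
  have hR1' : 0 ≤ R1 := measureReal_nonneg
  have hR2' : 0 ≤ R2 := measureReal_nonneg
  have hL1m : L1 ≤ m := measureReal_mono inter_subset_left
  rcases hm0.eq_or_lt with hm | hm
  · -- `μ(D) = 0`: the left-hand side vanishes
    have hL10 : L1 = 0 := le_antisymm (hm ▸ hL1m) measureReal_nonneg
    rw [hL10, zero_mul]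
    exact mul_nonneg hR1' hR2'
  · have h1 : m * L1 * (m * L2) ≤ a1 * b1 * (a2 * b2) :=
      mul_le_mul key_c key_d (mul_nonneg hm0 hL2') (mul_nonneg ha1' hb1')
    have h2 : a1 * a2 * (b1 * b2) ≤ m * R1 * (m * R2) :=
      mul_le_mul key_a key_b (mul_nonneg hb1' hb2') (mul_nonneg hm0 hR1')
    have h3 : m * m * (L1 * L2) ≤ m * m * (R1 * R2) :=
      calc m * m * (L1 * L2) = m * L1 * (m * L2) := by ring
        _ ≤ a1 * b1 * (a2 * b2) := h1
        _ = a1 * a2 * (b1 * b2) := by ring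
        _ ≤ m * R1 * (m * R2) := h2
        _ = m * m * (R1 * R2) := by ring
    exact le_of_mul_le_mul_left h3 (mul_pos hm hm)

/-! ## The general cluster-event exchange

Of the events `{x ↔ o}`, `{x ↔ z}`, `{y ↔ z}`, `{y ↔ o}` the four-line derivation of (C⁺) uses only
that the first two are increasing events determined by `C_x` and the last two increasing events
determined by `C_y`.  For arbitrary such events `A₁, A₂` (of `C_x`) and `B₁, B₂` (of `C_y`) the
same sandwich — BHK's Remark 2 after Thm. 1.2 (arXiv p. 4 / RSA p. 5: "conditioned on `R_{X∩Y}`,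
each of the pairs `(A, R_{X∖Y})`, `(B, R_{Y∖X})` is negatively correlated, while each of `(A,B)`,
`(R_{X∖Y}, R_{Y∖X})` is positively correlated. So …
`Pr'(A R_{X∖Y}) Pr'(B R_{Y∖X}) ≤ Pr'(A) Pr'(R_{X∖Y}) Pr'(B) Pr'(R_{Y∖X}) ≤ Pr'(A B) Pr'(R_{X∖Y} R_{Y∖X})`")
— gives, with `D = {x ↮ y}`,

  `μ(D ∩ (A₁ ∩ B₁)) · μ(D ∩ (A₂ ∩ B₂)) ≤ μ(D ∩ (A₁ ∩ A₂)) · μ(D ∩ (B₁ ∩ B₂))`       (C⁺_gen)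

(`clusterEventExchange`).  Examples of admissible events: `{x ↔ o₁} ∩ {x ↔ o₂}`, `⋃ o ∈ O, {x ↔ o}`
("`x` is joined to the set `O`"), `{e ∈ C_x}`.  (C⁺) is the case `A₁ = {x ↔ o}`, `A₂ = {x ↔ z}`,
`B₁ = {y ↔ z}`, `B₂ = {y ↔ o}`.  By BHK's Thm. 2.1 the same holds for random-cluster measures with
`q ≥ 1` and with `x, y` replaced by disjoint vertex sets; neither extension is formalised here. -/

namespace TripodExchange

/-- The indicator `C ↦ 1{P C}` of an increasing predicate of edge sets is increasing. [folklore] -/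
theorem predIndicator_monotone {P : Set (Sym2 V) → Prop} [DecidablePred P]
    (hP : ∀ ⦃C C' : Set (Sym2 V)⦄, C ⊆ C' → P C → P C') :
    Monotone fun C => (if P C then (1 : ℝ) else 0) := by
  intro C C' hCC'
  dsimp only
  by_cases h : P C
  · rw [if_pos h, if_pos (hP hCC' h)]
  · rw [if_neg h]
    split_ifs
    · exact zero_le_one
    · exact le_rfl

/-- `C ↦ -1{P C}` is decreasing for an increasing predicate `P`. [folklore] -/
theorem neg_predIndicator_antitone {P : Set (Sym2 V) → Prop} [DecidablePred P]
    (hP : ∀ ⦃C C' : Set (Sym2 V)⦄, C ⊆ C' → P C → P C') :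
    Antitone fun C => -(if P C then (1 : ℝ) else 0) :=
  fun _ _ h => neg_le_neg (predIndicator_monotone hP h)

/-- Evaluation on a configuration: `1{P (C_s ω)} = 1_{ {ω | P (C_s ω)} }(ω)`. [folklore] -/
theorem predIndicator_openEdgeCluster (P : Set (Sym2 V) → Prop) [DecidablePred P] (s : V)
    (ω : BondConfig V) :
    (if P (openEdgeCluster ω s) then (1 : ℝ) else 0) =
      ({ω' : BondConfig V | P (openEdgeCluster ω' s)}).indicator 1 ω := by
  by_cases h : P (openEdgeCluster ω s)
  · rw [if_pos h, indicator_of_mem (show ω ∈ {ω' : BondConfig V | P (openEdgeCluster ω' s)} from h),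
      Pi.one_apply]
  · rw [if_neg h, indicator_of_notMem (show ω ∉ {ω' : BondConfig V | P (openEdgeCluster ω' s)} from h)]

end TripodExchange

open TripodExchange in
/-- **Cluster-event exchange (the general form of the tripod exchange (C⁺)).**  Bond percolation
with arbitrary edge probabilities `w` on a finite vertex type; `x, y` vertices, `D = {x ↮ y}`;
`A₁ = {ω | P₁ (C_x ω)}`, `A₂ = {ω | P₂ (C_x ω)}` increasing events determined by the open edge
cluster `C_x = openEdgeCluster ω x`, and `B₁ = {ω | Q₁ (C_y ω)}`, `B₂ = {ω | Q₂ (C_y ω)}` increasing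
events determined by `C_y` (`Pᵢ, Qᵢ` predicates of edge sets, increasing for inclusion).  Then
`μ(D ∩ (A₁ ∩ B₁)) · μ(D ∩ (A₂ ∩ B₂)) ≤ μ(D ∩ (A₁ ∩ A₂)) · μ(D ∩ (B₁ ∩ B₂))`:
pairing like with like (both `x`-events in one factor, both `y`-events in the other) dominates the
crossed pairing.  Proof: four applications of van den Berg–Häggström–Kahn's Theorem 1.5
(`BHK2006_twoClusterConditionalAssociation_holds`) — `(1_{A₁}, 1_{A₂})`, `(−1_{B₁}, −1_{B₂})`,
`(1_{A₁}, −1_{B₁})`, `(1_{A₂}, −1_{B₂})` are pairs of functions of `(C_x, C_y)` increasing in `C_x`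
and decreasing in `C_y` — and the bookkeeping `m²·L₁L₂ ≤ (a₁b₁)(a₂b₂) = (a₁a₂)(b₁b₂) ≤ m²·R₁R₂`.
Not stated in print in this form; it is the pattern of BHK's Remark 2 after Thm. 1.2.
[cite: VandenbergHaggstromKahn2005, Thm. 1.5 (p. 7, eq. (9)) and Remark 2 after Thm. 1.2 (p. 5) — corollary, derived in this file] -/
theorem clusterEventExchange [Fintype V] (w : Sym2 V → unitInterval) (x y : V)
    (P₁ P₂ Q₁ Q₂ : Set (Sym2 V) → Prop)
    (hP₁ : ∀ ⦃C C' : Set (Sym2 V)⦄, C ⊆ C' → P₁ C → P₁ C')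
    (hP₂ : ∀ ⦃C C' : Set (Sym2 V)⦄, C ⊆ C' → P₂ C → P₂ C')
    (hQ₁ : ∀ ⦃C C' : Set (Sym2 V)⦄, C ⊆ C' → Q₁ C → Q₁ C')
    (hQ₂ : ∀ ⦃C C' : Set (Sym2 V)⦄, C ⊆ C' → Q₂ C → Q₂ C') :
    (prodBernoulli w).real ((openConn x y)ᶜ ∩
        ({ω | P₁ (openEdgeCluster ω x)} ∩ {ω | Q₁ (openEdgeCluster ω y)})) *
      (prodBernoulli w).real ((openConn x y)ᶜ ∩
        ({ω | P₂ (openEdgeCluster ω x)} ∩ {ω | Q₂ (openEdgeCluster ω y)})) ≤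
    (prodBernoulli w).real ((openConn x y)ᶜ ∩
        ({ω | P₁ (openEdgeCluster ω x)} ∩ {ω | P₂ (openEdgeCluster ω x)})) *
      (prodBernoulli w).real ((openConn x y)ᶜ ∩
        ({ω | Q₁ (openEdgeCluster ω y)} ∩ {ω | Q₂ (openEdgeCluster ω y)})) := by
  classical
  by_cases hxy : x = y
  · -- degenerate case: `{x ↮ x} = ∅`, both sides vanish
    have hc : (openConn x y : Set (BondConfig V))ᶜ = ∅ := by
      ext ω
      simp only [mem_compl_iff, mem_empty_iff_false, iff_false, not_not, hxy]
      exact SimpleGraph.Reachable.refl y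
    have h0 : ∀ S : Set (BondConfig V), (prodBernoulli w).real ((openConn x y)ᶜ ∩ S) = 0 :=
      fun S => by rw [hc, empty_inter, measureReal_empty]
    simp only [h0, zero_mul, le_refl]
  -- the four applications of BHK 2006, Thm. 1.5 (s = x, t = y)
  have key_a := BHK2006_twoClusterConditionalAssociation_holds V w x y
    (fun C _ => if P₁ C then (1 : ℝ) else 0) (fun C _ => if P₂ C then (1 : ℝ) else 0)
    (fun _ => predIndicator_monotone hP₁) (fun _ => antitone_const)
    (fun _ => predIndicator_monotone hP₂) (fun _ => antitone_const) hxy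
  have key_b := BHK2006_twoClusterConditionalAssociation_holds V w x y
    (fun _ E => -(if Q₁ E then (1 : ℝ) else 0)) (fun _ E => -(if Q₂ E then (1 : ℝ) else 0))
    (fun _ => monotone_const) (fun _ => neg_predIndicator_antitone hQ₁)
    (fun _ => monotone_const) (fun _ => neg_predIndicator_antitone hQ₂) hxy
  have key_c := BHK2006_twoClusterConditionalAssociation_holds V w x y
    (fun C _ => if P₁ C then (1 : ℝ) else 0) (fun _ E => -(if Q₁ E then (1 : ℝ) else 0))
    (fun _ => predIndicator_monotone hP₁) (fun _ => antitone_const)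
    (fun _ => monotone_const) (fun _ => neg_predIndicator_antitone hQ₁) hxy
  have key_d := BHK2006_twoClusterConditionalAssociation_holds V w x y
    (fun C _ => if P₂ C then (1 : ℝ) else 0) (fun _ E => -(if Q₂ E then (1 : ℝ) else 0))
    (fun _ => predIndicator_monotone hP₂) (fun _ => antitone_const)
    (fun _ => monotone_const) (fun _ => neg_predIndicator_antitone hQ₂) hxy
  have hDc : {ω : BondConfig V | ¬ (openGraph ω).Reachable x y} = (openConn x y)ᶜ := rfl
  simp only [hDc, predIndicator_openEdgeCluster, integral_neg, mul_neg, neg_mul, neg_neg,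
    neg_le_neg_iff] at key_a key_b key_c key_d
  simp only [setIntegral_indicator_one_eq, setIntegral_indicator_mul_indicator_eq]
    at key_a key_b key_c key_d
  -- bookkeeping: m² · L₁ L₂ ≤ (a₁ b₁)(a₂ b₂) = (a₁ a₂)(b₁ b₂) ≤ m² · R₁ R₂
  set μ := prodBernoulli w with hμ
  set m := μ.real (openConn x y)ᶜ with hm_def
  set a1 := μ.real ((openConn x y)ᶜ ∩ {ω | P₁ (openEdgeCluster ω x)}) with ha1
  set a2 := μ.real ((openConn x y)ᶜ ∩ {ω | P₂ (openEdgeCluster ω x)}) with ha2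
  set b1 := μ.real ((openConn x y)ᶜ ∩ {ω | Q₁ (openEdgeCluster ω y)}) with hb1
  set b2 := μ.real ((openConn x y)ᶜ ∩ {ω | Q₂ (openEdgeCluster ω y)}) with hb2
  set L1 := μ.real ((openConn x y)ᶜ ∩
    ({ω | P₁ (openEdgeCluster ω x)} ∩ {ω | Q₁ (openEdgeCluster ω y)})) with hL1
  set L2 := μ.real ((openConn x y)ᶜ ∩
    ({ω | P₂ (openEdgeCluster ω x)} ∩ {ω | Q₂ (openEdgeCluster ω y)})) with hL2
  set R1 := μ.real ((openConn x y)ᶜ ∩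
    ({ω | P₁ (openEdgeCluster ω x)} ∩ {ω | P₂ (openEdgeCluster ω x)})) with hR1
  set R2 := μ.real ((openConn x y)ᶜ ∩
    ({ω | Q₁ (openEdgeCluster ω y)} ∩ {ω | Q₂ (openEdgeCluster ω y)})) with hR2
  have hm0 : 0 ≤ m := measureReal_nonneg
  have ha1' : 0 ≤ a1 := measureReal_nonneg
  have hb1' : 0 ≤ b1 := measureReal_nonneg
  have hb2' : 0 ≤ b2 := measureReal_nonneg
  have hL2' : 0 ≤ L2 := measureReal_nonneg
  have hR1' : 0 ≤ R1 := measureReal_nonneg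
  have hR2' : 0 ≤ R2 := measureReal_nonneg
  have hL1m : L1 ≤ m := measureReal_mono inter_subset_left
  rcases hm0.eq_or_lt with hm | hm
  · -- `μ(D) = 0`: the left-hand side vanishes
    have hL10 : L1 = 0 := le_antisymm (hm ▸ hL1m) measureReal_nonneg
    rw [hL10, zero_mul]
    exact mul_nonneg hR1' hR2'
  · have h1 : m * L1 * (m * L2) ≤ a1 * b1 * (a2 * b2) :=
      mul_le_mul key_c key_d (mul_nonneg hm0 hL2') (mul_nonneg ha1' hb1')
    have h2 : a1 * a2 * (b1 * b2) ≤ m * R1 * (m * R2) :=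
      mul_le_mul key_a key_b (mul_nonneg hb1' hb2') (mul_nonneg hm0 hR1')
    have h3 : m * m * (L1 * L2) ≤ m * m * (R1 * R2) :=
      calc m * m * (L1 * L2) = m * L1 * (m * L2) := by ring
        _ ≤ a1 * b1 * (a2 * b2) := h1
        _ = a1 * a2 * (b1 * b2) := by ring
        _ ≤ m * R1 * (m * R2) := h2
        _ = m * m * (R1 * R2) := by ring
    exact le_of_mul_le_mul_left h3 (mul_pos hm hm)

end Literature.Probability.Percolation

end
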